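import Mathlib
import HarnessLib
import Summits.ResolutionOfSingularities.ResolutionOfSingularities.Theorems.WildQuotientsWildQuotientResolutionToricExitRootSubstInjective
import Summits.ResolutionOfSingularities.ResolutionOfSingularities.Theorems.WildQuotientsWildQuotientResolutionToricExitRootChartPresentation

/-!
# ℤ9 SPECIMEN (peeled `𝔸⁴/ℤ9`, char 3), brick Z4b part 4a: the SMOOTH vertex chart ring
# `(k[x][I₂₈ t])_{(x_c²⁸ t)} ≅ k[x]` by the terminal substitution `ψ₂`

(crux stmt-ResolutionOfSingularities-15640 `WildQuotients.WildQuotientResolution`, line `Sketch`; S1 =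
stmt-ResolutionOfSingularities-17941 `CyclicQuotientFourfolds`; chain w45c card-P specimen «peeled 𝔸⁴/ℤ9», variant
V-BR, brick Z4b part 4 = the seam `Γ(P₂) ≅ L₂` (design `L/res-L1-w45c-stub-3/Z4B-PART4-DESIGN.md`, step (4-A1).1).
[OURS · L1 W4.5c] — NOT a statement of any manuscript; AI-produced, kernel-checked ≠ expert-reviewed. Def-free;
letters of res-D-pv-033's Z2/Z3 files (abstract `g` with the exponent table) and of `…Z9PeeledTerminalLift`
(`tm₂`). Mould: res-L1-w45c-stub-1's `…Z9PeeledRootChartAWeightZero` / `…RootChartARing` (A1 with trivial weights).)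

* `aeval_term_eq_monomialTwist`, `aeval_term_injective` — `ψ₂` (`x_a ↦ x_a′s⁷`, `x_b ↦ x_b′s⁴`, rest fixed) is an
  injective monomial twist (`ToricExit.monomialTwist_injective`, `d = 1`);
* `term_gens` — the ratio law `ψ₂ (g_j) = q_j · ψ₂ (x_c²⁸)`, `q_j = x_a′^i x_b′^j s^{7i+4j+l−28}` (all 24 weights `≥ 28`);
* `adjoin_term_eq_top` — the chart ring model `k[ψ₂(x), q] = k[x]` (the vertex `x_c` has weight `1`: NO root is needed,
  `q_{(1,0,21)} = x_a′`, `q_{(0,1,24)} = x_b′`);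
* **`exists_chartRing23_ringEquiv`** — `e₁ : chartRing g 23 ≃+* k[x]` with `e₁ (F/1) = ψ₂ F` and `e₁ (g_j t/x_c²⁸ t) = q_j`
  (`ToricExit.nonempty_chartRing_ringEquiv_adjoin_of_rootData` with `N = 1`, `r = 1`).
Step (4-A1).2–3 (Mathlib `HomogeneousLocalization.Away.isLocalization_mul` at `normT 23 = (x_c²⁸t)·(σx_c²⁸t·σ²x_c²⁸t)`,
`t ↦ (v v')²⁸`, `B₂ ≅ L₂`) and (4-B)/(4-C) follow in part 4b.
-/

-- single-problem summit: the doubled namespace component `ResolutionOfSingularities` is forced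
set_option linter.dupNamespace false

noncomputable section

open MvPolynomial Literature.AlgebraicGeometry.Resolution

namespace Summit.ResolutionOfSingularities.ResolutionOfSingularities.Theorems.WildQuotientResolution.Z9Peeled.Terminal

variable (k : Type) [Field k] (n : ℕ) (a b c : Fin n)

/-- The exponent table of the 24 generators of `I₂₈` (res-D-pv-033's `e24`, verbatim). -/
local notation3 "e24" => (![(4, 0, 0), (3, 2, 0), (3, 1, 3), (3, 0, 7), (2, 4, 0), (2, 3, 2), (2, 2, 6), (2, 1, 10), (2, 0, 14), (1, 6, 0), (1, 5, 1), (1, 4, 5), (1, 3, 9), (1, 2, 13), (1, 1, 17), (1, 0, 21), (0, 7, 0), (0, 6, 4), (0, 5, 8), (0, 4, 12), (0, 3, 16), (0, 2, 20), (0, 1, 24), (0, 0, 28)] : Fin 24 → ℕ × ℕ × ℕ)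
/-- The terminal substitution `ψ₂` (res-L1-w45c-stub-3's `tm₂` of `…Z9PeeledTerminalLift`, verbatim). -/
local notation3 "tm₂" => (fun i : Fin n => if i = a then X a * X c ^ 7
    else if i = b then X b * X c ^ 4 else (X i : MvPolynomial (Fin n) k))
/-- The ratio monomials `q_j = ψ₂(g_j) / ψ₂(x_c²⁸)`. -/
local notation3 "q₂" => (fun j : Fin 24 => (X a ^ (e24 j).1 * X b ^ (e24 j).2.1 *
    X c ^ (7 * (e24 j).1 + 4 * (e24 j).2.1 + (e24 j).2.2 - 28) : MvPolynomial (Fin n) k))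

/-! ## The terminal substitution is an injective monomial twist -/

/-- `ψ₂` is the monomial twist `x_s ↦ x_s · x_c^{e_s}` with `e_a = 7`, `e_b = 4`, `e = 0` otherwise (`d = 1`). [folklore] -/
theorem aeval_term_eq_monomialTwist (hac : a ≠ c) (hbc : b ≠ c) :
    (aeval tm₂ : MvPolynomial (Fin n) k →ₐ[k] MvPolynomial (Fin n) k) =
      aeval (fun s : Fin n => (if s = c then X c ^ 1 else
        X s * X c ^ ((fun s : Fin n => if s = a then 7 else if s = b then 4 else 0) s) :
          MvPolynomial (Fin n) k)) := by
  refine MvPolynomial.algHom_ext fun i => ?_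
  rw [aeval_X, aeval_X]
  by_cases hia : i = a
  · subst hia; simp [hac]
  by_cases hib : i = b
  · subst hib; simp [hia, hbc]
  by_cases hic : i = c
  · subst hic; simp [hia, hib]
  · simp [hia, hib, hic]

variable {a b c} in
/-- `ψ₂` is injective. [folklore] -/
theorem aeval_term_injective (hac : a ≠ c) (hbc : b ≠ c) :
    Function.Injective (aeval tm₂ : MvPolynomial (Fin n) k →ₐ[k] MvPolynomial (Fin n) k) := by
  rw [aeval_term_eq_monomialTwist k n a b c hac hbc]
  exact ToricExit.monomialTwist_injective k n c 1 one_pos _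

/-! ## The ratio law and the chart model -/

variable {a b c} in
/-- The ratio law: `ψ₂ (g_j) = q_j · ψ₂ (g_23)` (`g_23 = x_c²⁸`, `ψ₂ (g_23) = s²⁸`) for the 24 generators of `I₂₈`
(every `(7,4,1)`-weight is `≥ 28`). [folklore] -/
theorem term_gens (hab : a ≠ b) (hac : a ≠ c) (hbc : b ≠ c)
    (g : Fin 24 → MvPolynomial (Fin n) k)
    (hg : ∀ q, g q = X a ^ (e24 q).1 * X b ^ (e24 q).2.1 * X c ^ (e24 q).2.2) (j : Fin 24) :
    aeval tm₂ (g j) = q₂ j * aeval tm₂ (g 23) := by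
  have hra : aeval tm₂ (X a : MvPolynomial (Fin n) k) = X a * X c ^ 7 := by rw [aeval_X]; simp
  have hrb : aeval tm₂ (X b : MvPolynomial (Fin n) k) = X b * X c ^ 4 := by rw [aeval_X]; simp [hab.symm]
  have hrc : aeval tm₂ (X c : MvPolynomial (Fin n) k) = X c := by rw [aeval_X]; simp [hac.symm, hbc.symm]
  rw [hg j, hg 23]
  simp only [map_mul, map_pow, hra, hrb, hrc]
  fin_cases j <;> simp <;> ring

variable {a b c} in
/-- **The chart model is all of `k[x]`**: `k[ψ₂(x), q] = k[x]` (`q_{15} = x_a′`, `q_{22} = x_b′`, `ψ₂ x_c = s`,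
`ψ₂ x_i = x_i` otherwise). [folklore] -/
theorem adjoin_term_eq_top (hac : a ≠ c) (hbc : b ≠ c) :
    Algebra.adjoin k (Set.range (fun s : Fin n => aeval tm₂ (X s : MvPolynomial (Fin n) k)) ∪ Set.range q₂) = ⊤ := by
  classical
  set E := Algebra.adjoin k (Set.range (fun s : Fin n => aeval tm₂ (X s : MvPolynomial (Fin n) k)) ∪ Set.range q₂)
    with hE
  have hES : ∀ s, aeval tm₂ (X s : MvPolynomial (Fin n) k) ∈ E :=
    fun s => Algebra.subset_adjoin (Or.inl ⟨s, rfl⟩)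
  have hEq : ∀ j, q₂ j ∈ E := fun j => Algebra.subset_adjoin (Or.inr ⟨j, rfl⟩)
  have hXa : (X a : MvPolynomial (Fin n) k) ∈ E := by
    have h := hEq 15
    simp only at h
    simpa using h
  have hXb : (X b : MvPolynomial (Fin n) k) ∈ E := by
    have h := hEq 22
    simp only at h
    simpa using h
  have hXc : (X c : MvPolynomial (Fin n) k) ∈ E := by
    have h := hES c
    rw [aeval_X] at h
    simpa [hac.symm, hbc.symm] using h
  have hX : ∀ i : Fin n, (X i : MvPolynomial (Fin n) k) ∈ E := by
    intro i
    by_cases hia : i = a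
    · rw [hia]; exact hXa
    by_cases hib : i = b
    · rw [hib]; exact hXb
    by_cases hic : i = c
    · rw [hic]; exact hXc
    · have h := hES i
      rw [aeval_X] at h
      simpa [hia, hib, hic] using h
  refine top_le_iff.mp ?_
  rw [← MvPolynomial.adjoin_range_X (σ := Fin n) (R := k), Algebra.adjoin_le_iff]
  rintro _ ⟨i, rfl⟩
  exact hX i

variable {a b c} in
/-- **(4-A1).1 — the smooth vertex chart ring is a polynomial ring**: there is a ring isomorphism
`e₁ : (k[x][I₂₈ t])_{(x_c²⁸ t)} ≃+* k[x]` (slot letters `s = X c`, `x_a′ = X a`, `x_b′ = X b`) with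
`e₁ (F/1) = ψ₂ F` and `e₁ (g_j t / x_c²⁸ t) = q_j`. [OURS · L1 W4.5c] -/
theorem exists_chartRing23_ringEquiv (hab : a ≠ b) (hac : a ≠ c) (hbc : b ≠ c)
    (g : Fin 24 → MvPolynomial (Fin n) k)
    (hg : ∀ q, g q = X a ^ (e24 q).1 * X b ^ (e24 q).2.1 * X c ^ (e24 q).2.2) :
    ∃ e₁ : chartRing g 23 ≃+* MvPolynomial (Fin n) k,
      (∀ F : MvPolynomial (Fin n) k, e₁ (chartBase g 23 F) = aeval tm₂ F) ∧
      ∀ j : Fin 24, e₁ (chartGen g 23 j) = q₂ j := by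
  classical
  have hg23 : g 23 = X c ^ 28 := by rw [hg 23]; simp
  have hci : g 23 ≠ 0 := by rw [hg23]; exact pow_ne_zero _ (X_ne_zero c)
  have hrc : aeval tm₂ (X c : MvPolynomial (Fin n) k) = X c := by rw [aeval_X]; simp [hac.symm, hbc.symm]
  have hunit : aeval tm₂ (g 23) * 1 = g 23 ^ 1 := by rw [hg23, map_pow, hrc, mul_one, pow_one]
  obtain ⟨e, he1, he2⟩ := ToricExit.nonempty_chartRing_ringEquiv_adjoin_of_rootData k g 23 hci (aeval tm₂)
    (aeval_term_injective k n hac hbc) 1 1 hunit q₂ (term_gens k n hab hac hbc g hg)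
  let eT : ↥(Algebra.adjoin k (Set.range (fun s : Fin n => aeval tm₂ (X s : MvPolynomial (Fin n) k)) ∪
      Set.range q₂)) ≃+* MvPolynomial (Fin n) k :=
    ((Subalgebra.equivOfEq _ _ (adjoin_term_eq_top k n hac hbc)).trans Subalgebra.topEquiv).toRingEquiv
  have heT : ∀ y, eT y = (y : MvPolynomial (Fin n) k) := fun y => rfl
  refine ⟨e.trans eT, fun F => ?_, fun j => ?_⟩
  · rw [RingEquiv.trans_apply, heT, he1]
  · rw [RingEquiv.trans_apply, heT, he2]

end Summit.ResolutionOfSingularities.ResolutionOfSingularities.Theorems.WildQuotientResolution.Z9Peeled.Terminal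

end
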